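import Literature.Probability.RandomPlanarGeometry.SAWBridgePatternRatio
import Literature.Probability.RandomPlanarGeometry.SAWBridgeRenewalEquation
import HarnessLib

/-!
# Kesten's `(U,Q) ↔ (V,Q)` swap preserves irreducibility of bridges (lane R42 «IRR-RATIO», R42.1–R42.2)

Topic `Literature/Probability/RandomPlanarGeometry` (continues `SAWKestenPatterns.lean` — Kesten's patterns
`U = N³E³S³`, `V = N³ESENES³`, occurrences `OccU`/`OccV`, the swaps `insV`/`delV` (Madras–Slade Theorem 7.3.2) —
`SAWBridgePatternRatio.lean` (`insV_mem_bridges`, `delV_mem_bridges`) and `SAWBridgeRenewalEquation.lean` /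
`SAWSubBallistic.lean` (renewal times `IsRenewalTime`, irreducible bridges `irreducibleBridges`)).

Source / rôle. Madras–Slade 1993, Theorem 7.3.2 and its proof (the one-to-two-step pattern swap behind Kesten's
ratio limit theorems): the tree has the swap on walks and on bridges; the lane's route R42 (a-idea-1 g9,
`Sketch_G9.lean` 7a35a84ae73a8f73) needs it on IRREDUCIBLE bridges, to run the generic ratio engine
`Zd.thm732W_of_bounds` on `λ_N` and obtain `λ_{N+2}/λ_N → μ²` (not in print). This file proves the two swap
stubs R42.1 `insV` and R42.2 `delV` preserve irreducibility.

Mechanism. The point set of `U` is contained in that of `V` (`V = U ∪ {(1,2),(2,2)}`), in the same order: with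
`σ(i) = i` (`i ≤ k+4`), `σ(i) = i+2` (`i ≥ k+5`) one has `delV k ω = ω ∘ σ` / `ω = (insV k ω) ∘ σ`, `σ` strictly
increasing with `σ 0 = 0`, `σ n = n+2`. For bridges a renewal time `r` is characterised by heights
(`x₁(i) ≤ x₁(r)` for `i ≤ r`, `x₁(r) < x₁(j)` for `j > r`), so renewal times transfer along `σ`
(`IsRenewalTime.of_comp_strictMono`, `isRenewalTime_of_comp_extra`); the two extra `V`-points `(1,2)`, `(2,2)`
are handled by their explicit heights. The induced correspondence of renewal times is `U`-time `k+4 ↔ V`-time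
`k+5`, `k+5 ↔ k+7`, `i ↔ i` (`i ≤ k+3`), `i ↔ i+2` (`i ≥ k+6`); `V`-time `k+6` is never a renewal time.

## Contents (namespace `Literature.Probability.RandomPlanarGeometry.SAW.Zd`; every `ℤ^{d+2}`)
* `IsRenewalTime.heights`, `isRenewalTime_of_heights` — renewal times of bridges via heights;
* `IsRenewalTime.of_comp_strictMono`, `isRenewalTime_of_comp_extra` — transfer along a time change;
* `swapσ k`, `eq_insV_comp_swapσ`, `delV_eq_comp_swapσ` — the `U ⊂ V` time change;
* **`insV_mem_irreducibleBridges`** (R42.1) and **`delV_mem_irreducibleBridges`** (R42.2).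
[cite: MadrasSlade1993, Theorem 7.3.2 (proof) and Definition 4.2.1]
-/

noncomputable section

open Finset Filter Topology
open scoped BigOperators
open Literature.Probability.LatticeModels Literature.Probability.Percolation

namespace Literature.Probability.RandomPlanarGeometry.SAW.Zd

variable {d : ℕ}

/-! ### Renewal times of bridges via heights -/

/-- The heights at a renewal time: everything before is `≤`, everything after is `>` (first coordinate).
[cite: MadrasSlade1993, Definition 4.2.1 (break points)] -/
theorem IsRenewalTime.heights {d : ℕ} [NeZero d] {n r : ℕ} {ω : ℕ → Site d} (h : IsRenewalTime n ω r) :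
    (∀ i ≤ r, ω i 0 ≤ ω r 0) ∧ ∀ j, r < j → j ≤ n → ω r 0 < ω j 0 := by
  obtain ⟨hrn, h1, h2⟩ := h
  refine ⟨fun i hi => ?_, fun j hj hjn => ?_⟩
  · rcases Nat.eq_zero_or_pos i with rfl | hi0
    · rcases Nat.eq_zero_or_pos r with rfl | hr0
      · exact le_rfl
      · exact (h1 r hr0 le_rfl).1.le
    · exact (h1 i hi0 hi).2
  · obtain ⟨i, rfl⟩ : ∃ i, j = r + i := ⟨j - r, by omega⟩
    have := (h2 i (by omega) (by omega)).1
    simpa using this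

/-- Conversely, for a BRIDGE the height conditions make `r` a renewal time.
[cite: MadrasSlade1993, Definition 4.2.1 (break points) and Definition 1.2.4] -/
theorem isRenewalTime_of_heights {d : ℕ} [NeZero d] {n r : ℕ} {ω : ℕ → Site d} (hω : ω ∈ bridges d n)
    (hr : r ≤ n) (h1 : ∀ i ≤ r, ω i 0 ≤ ω r 0) (h2 : ∀ j, r < j → j ≤ n → ω r 0 < ω j 0) :
    IsRenewalTime n ω r := by
  obtain ⟨-, hb⟩ := mem_bridges.1 hω
  refine ⟨hr, fun i hi1 hi2 => ⟨(hb i hi1 (hi2.trans hr)).1, h1 i hi2⟩, fun i hi1 hi2 => ⟨?_, ?_⟩⟩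
  · simpa using h2 (r + i) (by omega) (by omega)
  · have e : r + (n - r) = n := by omega
    simp only [e]
    rcases (show r + i ≤ n by omega).eq_or_lt with h | h
    · rw [h]
    · exact (hb (r + i) (by omega) (by omega)).2

/-! ### Transfer of renewal times along a strictly increasing time change -/

/-- **Transfer down**: if `ω = ω' ∘ σ` on `[0,n]` with `σ` strictly increasing, `σ 0 = 0`, `σ n = n'`, and `r'` is
a renewal time of `ω'` squeezed between `σ r ≤ r' < σ (r+1)` with the same height as `σ r`, then `r` is a
renewal time of the bridge `ω`. [cite: MadrasSlade1993, Theorem 7.3.2 (proof)] -/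
theorem IsRenewalTime.of_comp_strictMono {d : ℕ} [NeZero d] {n n' : ℕ} {ω ω' : ℕ → Site d} {σ : ℕ → ℕ}
    (hσ : StrictMono σ) (hσn : σ n = n') (hcomp : ∀ i ≤ n, ω i = ω' (σ i))
    (hω : ω ∈ bridges d n) {r r' : ℕ} (hr : r ≤ n) (h1 : σ r ≤ r') (h2 : r' < σ (r + 1) ∨ r = n)
    (hx : ω' (σ r) 0 = ω' r' 0) (hren : IsRenewalTime n' ω' r') : IsRenewalTime n ω r := by
  obtain ⟨hA, hB⟩ := hren.heights
  refine isRenewalTime_of_heights hω hr (fun i hi => ?_) (fun j hj hjn => ?_)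
  · rw [hcomp i (hi.trans hr), hcomp r hr, hx]
    exact hA (σ i) ((hσ.monotone hi).trans h1)
  · rw [hcomp j hjn, hcomp r hr, hx]
    refine hB (σ j) ?_ (by rw [← hσn]; exact hσ.monotone hjn)
    rcases h2 with h2 | rfl
    · exact lt_of_lt_of_le h2 (hσ.monotone (by omega))
    · omega

/-- **Transfer up**: if `ω = ω' ∘ σ` as above, `r` is a renewal time of `ω`, `σ r ≤ r'' < σ (r+1)` has the height of
`σ r`, and the times of `ω'` OUTSIDE the range of `σ` respect the heights at `r''`, then `r''` is a renewal time
of the bridge `ω'`. [cite: MadrasSlade1993, Theorem 7.3.2 (proof)] -/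
theorem isRenewalTime_of_comp_extra {d : ℕ} [NeZero d] {n n' : ℕ} {ω ω' : ℕ → Site d} {σ : ℕ → ℕ}
    (hσ : StrictMono σ) (hσn : σ n = n') (hcomp : ∀ i ≤ n, ω i = ω' (σ i))
    (hω' : ω' ∈ bridges d n') {r r'' : ℕ} (hr : r ≤ n) (hr'' : r'' ≤ n') (h1 : σ r ≤ r'')
    (h2 : r'' < σ (r + 1) ∨ r = n) (hx : ω' (σ r) 0 = ω' r'' 0)
    (hextra : ∀ t ≤ n', (∀ i ≤ n, σ i ≠ t) →
      (t ≤ r'' → ω' t 0 ≤ ω' r'' 0) ∧ (r'' < t → ω' r'' 0 < ω' t 0))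
    (hren : IsRenewalTime n ω r) : IsRenewalTime n' ω' r'' := by
  obtain ⟨hA, hB⟩ := hren.heights
  refine isRenewalTime_of_heights hω' hr'' (fun t ht => ?_) (fun t ht htn => ?_)
  · by_cases hrange : ∃ i ≤ n, σ i = t
    · obtain ⟨i, hi, rfl⟩ := hrange
      have hir : i ≤ r := by
        rcases h2 with h2 | rfl
        · by_contra hlt
          have : σ (r + 1) ≤ σ i := hσ.monotone (by omega)
          omega
        · exact hi
      rw [← hcomp i hi, ← hx, ← hcomp r hr]
      exact hA i hir
    · have : ∀ i ≤ n, σ i ≠ t := fun i hi heq => hrange ⟨i, hi, heq⟩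
      exact (hextra t (ht.trans hr'') this).1 ht
  · by_cases hrange : ∃ i ≤ n, σ i = t
    · obtain ⟨j, hj, rfl⟩ := hrange
      have hrj : r < j := by
        by_contra hle
        have : σ j ≤ σ r := hσ.monotone (by omega)
        omega
      rw [← hcomp j hj, ← hx, ← hcomp r hr]
      exact hB j hrj hj
    · have : ∀ i ≤ n, σ i ≠ t := fun i hi heq => hrange ⟨i, hi, heq⟩
      exact (hextra t htn this).2 ht

/-! ### The time change of the `U ⊂ V` inclusion -/

/-- The time change `σ`: `U`-time `i ≤ k+4` is `V`-time `i`; `U`-time `i ≥ k+5` is `V`-time `i+2` (the `V`-points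
`(1,2)`, `(2,2)` at `V`-times `k+5`, `k+6` are skipped). [cite: MadrasSlade1993, Theorem 7.3.2 (proof)] -/
def swapσ (k : ℕ) (i : ℕ) : ℕ := if i ≤ k + 4 then i else i + 2

/-- `σ` is strictly increasing. [cite: MadrasSlade1993, Theorem 7.3.2 (proof)] -/
theorem strictMono_swapσ (k : ℕ) : StrictMono (swapσ k) := by
  intro a b hab
  unfold swapσ
  split_ifs <;> omega

/-- Values of `σ`. [cite: MadrasSlade1993, Theorem 7.3.2 (proof)] -/
theorem swapσ_of_le {k i : ℕ} (h : i ≤ k + 4) : swapσ k i = i := if_pos h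

/-- Values of `σ`. [cite: MadrasSlade1993, Theorem 7.3.2 (proof)] -/
theorem swapσ_of_gt {k i : ℕ} (h : k + 4 < i) : swapσ k i = i + 2 := if_neg (not_le.2 h)

/-- The times of `[0, n+2]` skipped by `σ` are exactly `k+5` and `k+6`. [cite: MadrasSlade1993, Theorem 7.3.2 (proof)] -/
theorem eq_of_not_range_swapσ {k n t : ℕ} (hkn : k + 5 ≤ n) (ht : t ≤ n + 2) (h : ∀ i ≤ n, swapσ k i ≠ t) :
    t = k + 5 ∨ t = k + 6 := by
  by_contra hne
  rcases le_or_gt t (k + 4) with h1 | h1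
  · exact h t (by omega) (swapσ_of_le h1)
  · have : t - 2 ≤ n := by omega
    apply h (t - 2) this
    rw [swapσ_of_gt (by omega)]
    omega

/-- The patterns agree up to time `4` and `U(t) = V(t+2)` for `5 ≤ t ≤ 9` (`U ⊂ V` as ordered point sets).
[cite: MadrasSlade1993, Theorem 7.3.2 (proof), Fig. 7.4] -/
theorem uPt_eq_vPt_swap (t : ℕ) (ht : t ≤ 9) :
    (uPt t : Site (d + 2)) = vPt (if t ≤ 4 then t else t + 2) := by
  interval_cases t <;> simp [uPt, vPt, uCoord, vCoord]

/-- **`ω = (insV k ω) ∘ σ`** on `[0, n]` when `(U,Q)` occurs at `k`. [cite: MadrasSlade1993, Theorem 7.3.2 (proof)] -/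
theorem eq_insV_comp_swapσ {n k : ℕ} {ω : ℕ → Site (d + 2)} (hk : OccU n ω k) :
    ∀ i ≤ n, ω i = insV k ω (swapσ k i) := by
  obtain ⟨hkn, hseg, -⟩ := hk
  intro i hi
  rcases le_or_gt i k with h0 | h0
  · rw [swapσ_of_le (by omega), insV_apply_of_le k ω h0]
  rcases le_or_gt i (k + 9) with h9 | h9
  · obtain ⟨t, rfl⟩ : ∃ t, i = k + t := ⟨i - k, by omega⟩
    have ht9 : t ≤ 9 := by omega
    rw [hseg t ht9, uPt_eq_vPt_swap t ht9]
    by_cases ht4 : t ≤ 4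
    · rw [if_pos ht4, swapσ_of_le (by omega), insV_apply_window k ω (by omega)]
    · rw [if_neg ht4, swapσ_of_gt (by omega), show k + t + 2 = k + (t + 2) by omega,
        insV_apply_window k ω (by omega)]
  · rw [swapσ_of_gt (by omega), insV_apply_of_gt k ω (by omega)]
    simp

/-- **`delV k ω = ω ∘ σ`** on `[0, n]` when `(V,Q)` occurs at `k` in the `(n+2)`-step walk `ω`.
[cite: MadrasSlade1993, Theorem 7.3.2 (proof)] -/
theorem delV_eq_comp_swapσ {n k : ℕ} {ω : ℕ → Site (d + 2)} (hk : OccV (n + 2) ω k) :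
    ∀ i ≤ n, delV k ω i = ω (swapσ k i) := by
  obtain ⟨hkn, hseg, -⟩ := hk
  intro i hi
  rcases le_or_gt i k with h0 | h0
  · rw [swapσ_of_le (by omega), delV_apply_of_le k ω h0]
  rcases le_or_gt i (k + 9) with h9 | h9
  · obtain ⟨t, rfl⟩ : ∃ t, i = k + t := ⟨i - k, by omega⟩
    have ht9 : t ≤ 9 := by omega
    rw [delV_apply_window k ω ht9, uPt_eq_vPt_swap t ht9]
    by_cases ht4 : t ≤ 4
    · rw [if_pos ht4, swapσ_of_le (by omega), hseg t (by omega)]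
    · rw [if_neg ht4, swapσ_of_gt (by omega), show k + t + 2 = k + (t + 2) by omega, hseg (t + 2) (by omega)]
  · rw [swapσ_of_gt (by omega), delV_apply_of_gt k ω (by omega)]

/-- Heights of the `V`-window of `insV k ω`: `x₁(k + t) = x₁(k) + (vCoord t).1`. [cite: MadrasSlade1993, Theorem 7.3.2 (proof)] -/
theorem insV_window_height {n k : ℕ} {ω : ℕ → Site (d + 2)} (hk : OccU n ω k) {t : ℕ} (ht : t ≤ 11) :
    insV k ω (k + t) 0 = ω k 0 + (vCoord t).1 := by
  have := hk.1
  rw [insV_apply_window k ω ht, Pi.add_apply, vPt_apply_zero]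

/-- Heights of the `V`-window of a walk with a `(V,Q)`-occurrence. [cite: MadrasSlade1993, Theorem 7.3.2 (proof)] -/
theorem occV_window_height {m k : ℕ} {ω : ℕ → Site (d + 2)} (hk : OccV m ω k) {t : ℕ} (ht : t ≤ 11) :
    ω (k + t) 0 = ω k 0 + (vCoord t).1 := by
  rw [hk.2.1 t ht, Pi.add_apply, vPt_apply_zero]

/-! ### R42.1 and R42.2 -/

/-- **R42.1 — the swap `(U,Q) → (V,Q)` preserves irreducibility**: if `ω` is an irreducible `n`-step bridge with
an occurrence of `(U,Q)` at step `k`, then `insV k ω` is an irreducible `(n+2)`-step bridge.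
[cite: MadrasSlade1993, Theorem 7.3.2 (proof) and Definition 4.2.1] -/
theorem insV_mem_irreducibleBridges {n k : ℕ} {ω : ℕ → Site (d + 2)}
    (hω : ω ∈ irreducibleBridges (d + 2) n) (hk : OccU n ω k) :
    insV k ω ∈ irreducibleBridges (d + 2) (n + 2) := by
  obtain ⟨hb, -, -, hirr⟩ := mem_irreducibleBridges.1 hω
  have hkn : k + 9 ≤ n := hk.1
  have hb' : insV k ω ∈ bridges (d + 2) (n + 2) := insV_mem_bridges hb hk
  have hcomp := eq_insV_comp_swapσ hk
  refine mem_irreducibleBridges.2 ⟨hb', by omega, (mem_bridges.1 hb').2, fun r' hr1 hr2 hren => ?_⟩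
  -- the `V`-time `k + 6` (the point `(2,2)`) is never a renewal time: the next point has the same height
  by_cases h6 : r' = k + 6
  · subst h6
    have h := (hren.heights.2 (k + 7) (by omega) (by omega))
    rw [insV_window_height hk (by norm_num : 6 ≤ 11), insV_window_height hk (by norm_num : 7 ≤ 11)] at h
    simp [vCoord] at h
  -- otherwise transfer down to a renewal time `r ∈ [1, n-1]` of `ω`
  have key : ∃ r, 1 ≤ r ∧ r ≤ n - 1 ∧ swapσ k r ≤ r' ∧ r' < swapσ k (r + 1) ∧
      insV k ω (swapσ k r) 0 = insV k ω r' 0 := by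
    rcases le_or_gt r' (k + 4) with h4 | h4
    · exact ⟨r', hr1, by omega, by rw [swapσ_of_le h4], by
        rcases lt_or_ge r' (k + 4) with h | h
        · rw [swapσ_of_le (by omega)]; omega
        · rw [swapσ_of_gt (by omega)]; omega, by rw [swapσ_of_le h4]⟩
    rcases Nat.lt_or_ge r' (k + 7) with h7 | h7
    · -- r' = k + 5 (the point `(1,2)`): same height as `U`-time `k+4`
      have hr5 : r' = k + 5 := by omega
      subst hr5
      refine ⟨k + 4, by omega, by omega, by rw [swapσ_of_le le_rfl]; omega,
        by rw [swapσ_of_gt (by omega)]; omega, ?_⟩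
      rw [swapσ_of_le le_rfl, insV_window_height hk (by norm_num : 4 ≤ 11),
        insV_window_height hk (by norm_num : 5 ≤ 11)]
      simp [vCoord]
    · refine ⟨r' - 2, by omega, by omega, by rw [swapσ_of_gt (by omega)]; omega,
        by rw [swapσ_of_gt (by omega)]; omega, by rw [swapσ_of_gt (by omega), Nat.sub_add_cancel (by omega)]⟩
  obtain ⟨r, hr1', hr2', hs1, hs2, hx⟩ := key
  have hren' : IsRenewalTime n ω r :=
    IsRenewalTime.of_comp_strictMono (strictMono_swapσ k) (by rw [swapσ_of_gt (by omega)]) hcomp hb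
      (by omega) hs1 (Or.inl hs2) hx hren
  exact hirr r hr1' hr2' hren'

/-- **R42.2 — the inverse swap `(V,Q) → (U,Q)` preserves irreducibility**: if `ω` is an irreducible
`(n+2)`-step bridge with an occurrence of `(V,Q)` at step `k`, then `delV k ω` is an irreducible `n`-step bridge.
[cite: MadrasSlade1993, Theorem 7.3.2 (proof) and Definition 4.2.1] -/
theorem delV_mem_irreducibleBridges {n k : ℕ} {ω : ℕ → Site (d + 2)}
    (hω : ω ∈ irreducibleBridges (d + 2) (n + 2)) (hk : OccV (n + 2) ω k) :
    delV k ω ∈ irreducibleBridges (d + 2) n := by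
  obtain ⟨hb, -, -, hirr⟩ := mem_irreducibleBridges.1 hω
  have hkn : k + 9 ≤ n := by have := hk.1; omega
  have hb' : delV k ω ∈ bridges (d + 2) n := delV_mem_bridges hb hk
  have hcomp := delV_eq_comp_swapσ hk
  refine mem_irreducibleBridges.2 ⟨hb', by omega, (mem_bridges.1 hb').2, fun r hr1 hr2 hren => ?_⟩
  obtain ⟨hA, hB⟩ := hren.heights
  -- heights of the two skipped `V`-points
  have hV5 : ω (k + 5) 0 = ω k 0 + 1 := by rw [occV_window_height hk (by norm_num : 5 ≤ 11)]; simp [vCoord]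
  have hV6 : ω (k + 6) 0 = ω k 0 + 2 := by rw [occV_window_height hk (by norm_num : 6 ≤ 11)]; simp [vCoord]
  have hU4 : delV k ω (k + 4) 0 = ω k 0 + 1 := by
    rw [hcomp (k + 4) (by omega), swapσ_of_le le_rfl, occV_window_height hk (by norm_num : 4 ≤ 11)]
    simp [vCoord]
  have hU5 : delV k ω (k + 5) 0 = ω k 0 + 2 := by
    rw [hcomp (k + 5) (by omega), swapσ_of_gt (by omega), show k + 5 + 2 = k + 7 by omega,
      occV_window_height hk (by norm_num : 7 ≤ 11)]
    simp [vCoord]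
  -- choose the `V`-time `r''`
  have key : ∃ r'', 1 ≤ r'' ∧ r'' ≤ n + 1 ∧ swapσ k r ≤ r'' ∧ r'' < swapσ k (r + 1) ∧
      ω (swapσ k r) 0 = ω r'' 0 ∧
      (ω (k + 5) 0 ≤ ω r'' 0 ↔ k + 5 ≤ r'') ∧ (ω (k + 6) 0 ≤ ω r'' 0 ↔ k + 6 ≤ r'') := by
    rcases Nat.lt_or_ge r (k + 4) with h4 | h4
    · -- r ≤ k + 3: same time; the skipped points lie after and are higher
      have hlt : delV k ω r 0 < ω k 0 + 1 := by rw [← hU4]; exact hB (k + 4) (by omega) (by omega)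
      have hωr : ω r 0 = delV k ω r 0 := by rw [hcomp r (by omega), swapσ_of_le (by omega)]
      refine ⟨r, hr1, by omega, by rw [swapσ_of_le (by omega)], by rw [swapσ_of_le (by omega)]; omega,
        by rw [swapσ_of_le (by omega)], ?_, ?_⟩
      · rw [hV5, hωr]
        exact ⟨fun h => absurd h (not_le.2 hlt), fun h => by omega⟩
      · rw [hV6, hωr]
        exact ⟨fun h => by linarith, fun h => by omega⟩
    rcases h4.eq_or_lt with h44 | h5
    · -- r = k + 4: the `V`-time is `k + 5`
      subst h44
      refine ⟨k + 5, by omega, by omega, by rw [swapσ_of_le le_rfl]; omega,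
        by rw [swapσ_of_gt (by omega)]; omega, ?_, ?_, ?_⟩
      · rw [swapσ_of_le le_rfl, occV_window_height hk (by norm_num : 4 ≤ 11), hV5]; simp [vCoord]
      · rw [hV5]
        exact ⟨fun _ => le_rfl, fun _ => le_rfl⟩
      · rw [hV5, hV6]
        exact ⟨fun h => by linarith, fun h => by omega⟩
    · -- r ≥ k + 5: the `V`-time is `r + 2 ≥ k + 7`; both skipped points are before and not higher
      have hle : ω k 0 + 2 ≤ delV k ω r 0 := by rw [← hU5]; exact hA (k + 5) (by omega)
      have hωr : ω (r + 2) 0 = delV k ω r 0 := by rw [hcomp r (by omega), swapσ_of_gt (by omega)]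
      refine ⟨r + 2, by omega, by omega, by rw [swapσ_of_gt (by omega)], by rw [swapσ_of_gt (by omega)]; omega,
        by rw [swapσ_of_gt (by omega)], ?_, ?_⟩
      · rw [hV5, hωr]
        exact ⟨fun _ => by omega, fun _ => by linarith⟩
      · rw [hV6, hωr]
        exact ⟨fun _ => by omega, fun _ => by linarith⟩
  obtain ⟨r'', hr1'', hr2'', hs1, hs2, hx, h5iff, h6iff⟩ := key
  have hren'' : IsRenewalTime (n + 2) ω r'' := by
    refine isRenewalTime_of_comp_extra (strictMono_swapσ k) (by rw [swapσ_of_gt (by omega)]) hcomp hb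
      (by omega) (by omega) hs1 (Or.inl hs2) hx (fun t ht hnot => ?_) hren
    rcases eq_of_not_range_swapσ (by omega) ht hnot with rfl | rfl
    · refine ⟨fun h => h5iff.2 h, fun h => ?_⟩
      have : ¬ ω (k + 5) 0 ≤ ω r'' 0 := fun h' => by have := h5iff.1 h'; omega
      exact lt_of_not_ge this
    · refine ⟨fun h => h6iff.2 h, fun h => ?_⟩
      have : ¬ ω (k + 6) 0 ≤ ω r'' 0 := fun h' => by have := h6iff.1 h'; omega
      exact lt_of_not_ge this
  exact hirr r'' hr1'' hr2'' hren''

end Literature.Probability.RandomPlanarGeometry.SAW.Zd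

end
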